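import Mathlib
import HarnessLib
import Summits.Parity.GeneralizedHardyLittlewood.Theses.LeeYangFibres
import Summits.Parity.GeneralizedHardyLittlewood.Theorems.LeeYangFibresAbsoluteUpgradeDipDefs
import Summits.Parity.GeneralizedHardyLittlewood.Theorems.LeeYangFibresFibreHyperbolicityAlongDefs
import Summits.Parity.GeneralizedHardyLittlewood.Theorems.LeeYangFibresAbsoluteUpgradeQuantClipNumerics
import Summits.Parity.GeneralizedHardyLittlewood.Theorems.LeeYangFibresHyperbolicityClipsParityFibreAlgebra

/-!
# Crux `FibreHyperbolicityAlong` (stmt-Parity-18103), line `sifted-chowla-distillation`: the transfer stub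

Registered stub `stub_transferAlong` of the skeleton
`Cruxes/FibreHyperbolicityAlong/Lines/sifted_chowla_distillation.lean` (line lead
`prover-line-stmt-Parity-18103-0`), PROVED:

  `CellsNearRankOneAlong → RobustRowExp → DipMarginRateExchange.FibreHyperbolicityAlong`.

Cells near rank one + robust row ⟹ the crux in dip form.  Given `t, L, η`: let `C₀ > 0`, `u₀` be the
constants of `RobustRowExp`; invoke `CellsNearRankOneAlong` at `C := C₀ + t` (threshold `N₀`) and the schedule
lemma `quantClip_schedule u₀` (threshold `N₁`, so that `u₀ ≤ U := slowDegree N`; `4 ≤ U` always).  For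
`N ≥ max N₀ N₁` and an admissible `(Ψ, K, i, w, ζ)` with scale `M > 0`:

* the fibre is `Σ_{m=1}^U p_m ζ^m` (`ModelTransfer.fibreExpand`), `p_m = Σ_{j_i = m} C_j ∏_{k≠i} w_k^{j_k}`;
* (product–sum over the fibre `{j_i = m}` of the box, `HyperbolicityClipsParity.sum_filter_piFinset_prod`)
  `|p_m − M G I_m(U)| ≤ 2^{t-1} e^{-CU} M G · rowTol m U`, where `G = ∏_{k≠i} Σ_{n=1}^U I_n(U) w_k^n > 0`
  (`I_1 = 1`, `w_k > 0`) and each tolerance factor `Σ_n rowTol n U · w_k^n ≤ 2 Σ_n I_n(U) w_k^n` (the extra top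
  term `I_{U-1}(U) w^U` is at most the `n = U-1` term);
* the normalised row `b_j := p_{j+1}/(M G)` satisfies `|b_j − I_{j+1}(U)| ≤ e^{-C₀U} rowTol (j+1) U`
  because `2^{t-1} e^{-tU} ≤ 1`;
* the fibre equals `(M G) ζ Σ_{j<U} b_j ζ^j`, so a zero `ζ ≠ 0` is a zero of the row and `RobustRowExp`
  (at `u = U ≥ u₀`) makes it real.

Pattern: `ModelTransfer.stub_coeffBound` / `stub_assemble` (fixed `u`), with `rowTol` weights.
-/

noncomputable section

namespace Summit.Parity.GeneralizedHardyLittlewood.Cruxes.FibreHyperbolicityAlong.SiftedChowlaDistillation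

open scoped BigOperators Classical
open Literature.NumberTheory.Sieve
open Summit.Parity.GeneralizedHardyLittlewood.Theses.LeeYangFibres (CellParityLawSaving)
open Summit.Parity.GeneralizedHardyLittlewood.Cruxes.AbsoluteUpgrade.DipMarginRateExchange (slowDegree)
open Summit.Parity.GeneralizedHardyLittlewood.Cruxes.ModelHyperbolicity.WindowChainTransport (cellDensity)
open Summit.Parity.GeneralizedHardyLittlewood.Cruxes.FibreHyperbolicity.ModelTransfer (jointCell fibre)
open Summit.Parity.GeneralizedHardyLittlewood.Cruxes.AbsoluteUpgrade.NlcCellsAbsoluteClip (roughTuples)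
open Summit.Parity.GeneralizedHardyLittlewood.Theorems.ModelHyperbolicity.Negative (cell)

open Summit.Parity.GeneralizedHardyLittlewood.Cruxes.AbsoluteUpgrade.DipMarginRateExchange
  (four_le_slowDegree quantClip_schedule)
open Summit.Parity.GeneralizedHardyLittlewood.Cruxes.ModelHyperbolicity.WindowChainTransport
  (cellDensity_zero calc_nonneg)
open Summit.Parity.GeneralizedHardyLittlewood.Cruxes.FibreHyperbolicity.ModelTransfer (fibreExpand)
open Summit.Parity.GeneralizedHardyLittlewood.Theorems.HyperbolicityClipsParity (sum_filter_piFinset_prod)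

/-! ## Finite algebra on a fibre of the box -/

/-- The model sum on a fibre of the box factorises:
`∑_{j ∈ [1,u]^t, j_i = m} (∏_k a(j_k)) ∏_{k ≠ i} w_k^{j_k} = a(m) ∏_{k ≠ i} ∑_{n=1}^u a(n) w_k^n`. -/
private theorem fibre_modelSum_along {t u : ℕ} (i : Fin t) {m : ℕ} (hm : m ∈ Finset.Icc 1 u)
    (a : ℕ → ℝ) (w : Fin t → ℝ) :
    ∑ j ∈ (Fintype.piFinset fun _ : Fin t => Finset.Icc 1 u).filter (fun j => j i = m),
        (∏ k, a (j k)) * ∏ k ∈ Finset.univ.erase i, w k ^ (j k) =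
      a m * ∏ k ∈ Finset.univ.erase i, ∑ n ∈ Finset.Icc 1 u, a n * w k ^ n := by
  -- adapted from `ModelTransfer.fibre_modelSum` (Theorems/LeeYangFibresFibreHyperbolicityCoeffBound.lean)
  let f : Fin t → ℕ → ℝ := fun k n => a n * (if k = i then 1 else w k ^ n)
  have key := sum_filter_piFinset_prod (fun _ : Fin t => Finset.Icc 1 u) i hm f
  have hfi : f i m = a m := by simp [f]
  have hfk : ∀ k ∈ Finset.univ.erase i, ∀ n, f k n = a n * w k ^ n := by
    intro k hk n
    simp [f, Finset.ne_of_mem_erase hk]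
  have hprod : ∀ j : Fin t → ℕ,
      ∏ k, f k (j k) = (∏ k, a (j k)) * ∏ k ∈ Finset.univ.erase i, w k ^ (j k) := by
    intro j
    simp only [f, Finset.prod_mul_distrib]
    congr 1
    rw [← Finset.mul_prod_erase Finset.univ _ (Finset.mem_univ i), if_pos rfl, one_mul]
    exact Finset.prod_congr rfl fun k hk => if_neg (Finset.ne_of_mem_erase hk)
  rw [hfi, Finset.prod_congr rfl fun k hk => Finset.sum_congr rfl fun n _ => hfk k hk n] at key
  rw [← key]
  exact Finset.sum_congr rfl fun j _ => (hprod j).symm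

/-- **Weighted fibre coefficient bound** (abstract arrays).  If `|C_j − M ∏_k I(j_k)| ≤ ε M ∏_k R(j_k)` on the
box `[1,u]^t` with `I, R ≥ 0`, fugacities `w ≥ 0` and tolerance factors `Σ_n R(n) w_k^n ≤ 2 Σ_n I(n) w_k^n`, then
the `m`-th fibre coefficient `p_m = Σ_{j_i = m} C_j ∏_{k≠i} w_k^{j_k}` satisfies
`|p_m − M G I(m)| ≤ 2^{t-1} ε (M G) R(m)`, `G = ∏_{k≠i} Σ_{n=1}^u I(n) w_k^n`. -/
private theorem coeffBound_weighted {t u : ℕ} (i : Fin t) (C : (Fin t → ℕ) → ℝ) (I R : ℕ → ℝ)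
    {M ε : ℝ} (w : Fin t → ℝ) (hI : ∀ n, 0 ≤ I n) (hR : ∀ n, 0 ≤ R n) (hM : 0 ≤ M) (hε : 0 ≤ ε)
    (hw : ∀ k, 0 ≤ w k)
    (hfac : ∀ k, ∑ n ∈ Finset.Icc 1 u, R n * w k ^ n ≤ 2 * ∑ n ∈ Finset.Icc 1 u, I n * w k ^ n)
    (hC : ∀ j ∈ Fintype.piFinset (fun _ : Fin t => Finset.Icc 1 u),
      |C j - M * ∏ k, I (j k)| ≤ ε * M * ∏ k, R (j k))
    {m : ℕ} (hm : m ∈ Finset.Icc 1 u) :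
    |(∑ j ∈ (Fintype.piFinset (fun _ : Fin t => Finset.Icc 1 u)).filter (fun j => j i = m),
        C j * ∏ k ∈ Finset.univ.erase i, w k ^ (j k)) -
      M * (∏ k ∈ Finset.univ.erase i, ∑ n ∈ Finset.Icc 1 u, I n * w k ^ n) * I m| ≤
    2 ^ (t - 1) * ε * (M * ∏ k ∈ Finset.univ.erase i, ∑ n ∈ Finset.Icc 1 u, I n * w k ^ n) * R m := by
  set box : Finset (Fin t → ℕ) := Fintype.piFinset (fun _ : Fin t => Finset.Icc 1 u) with hbox
  set P : ℝ := ∏ k ∈ Finset.univ.erase i, ∑ n ∈ Finset.Icc 1 u, I n * w k ^ n with hP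
  have hWnn : ∀ j : Fin t → ℕ, 0 ≤ ∏ k ∈ Finset.univ.erase i, w k ^ (j k) :=
    fun j => Finset.prod_nonneg fun k _ => pow_nonneg (hw k) _
  have hFnn : ∀ k, 0 ≤ ∑ n ∈ Finset.Icc 1 u, I n * w k ^ n :=
    fun k => Finset.sum_nonneg fun n _ => mul_nonneg (hI n) (pow_nonneg (hw k) n)
  -- the main term factorises
  have hmain : ∑ j ∈ box.filter (fun j => j i = m),
      (M * ∏ k, I (j k)) * ∏ k ∈ Finset.univ.erase i, w k ^ (j k) = M * P * I m := by
    have h := fibre_modelSum_along i hm I w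
    rw [← hbox] at h
    calc ∑ j ∈ box.filter (fun j => j i = m),
          (M * ∏ k, I (j k)) * ∏ k ∈ Finset.univ.erase i, w k ^ (j k)
        = M * ∑ j ∈ box.filter (fun j => j i = m),
            (∏ k, I (j k)) * ∏ k ∈ Finset.univ.erase i, w k ^ (j k) := by
          rw [Finset.mul_sum]
          exact Finset.sum_congr rfl fun j _ => by ring
      _ = M * P * I m := by rw [h, hP]; ring
  -- the difference is the weighted sum of the cell errors
  have hdiff : (∑ j ∈ box.filter (fun j => j i = m),
      C j * ∏ k ∈ Finset.univ.erase i, w k ^ (j k)) - M * P * I m =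
      ∑ j ∈ box.filter (fun j => j i = m),
        (C j - M * ∏ k, I (j k)) * ∏ k ∈ Finset.univ.erase i, w k ^ (j k) := by
    rw [← hmain, ← Finset.sum_sub_distrib]
    exact Finset.sum_congr rfl fun j _ => by ring
  -- termwise bound
  have hterm : ∀ j ∈ box.filter (fun j => j i = m),
      |(C j - M * ∏ k, I (j k)) * ∏ k ∈ Finset.univ.erase i, w k ^ (j k)| ≤
        ε * M * ((∏ k, R (j k)) * ∏ k ∈ Finset.univ.erase i, w k ^ (j k)) := by
    intro j hj
    have hjb : j ∈ box := (Finset.mem_filter.1 hj).1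
    rw [abs_mul, abs_of_nonneg (hWnn j)]
    calc |C j - M * ∏ k, I (j k)| * ∏ k ∈ Finset.univ.erase i, w k ^ (j k)
        ≤ (ε * M * ∏ k, R (j k)) * ∏ k ∈ Finset.univ.erase i, w k ^ (j k) :=
          mul_le_mul_of_nonneg_right (hC j hjb) (hWnn j)
      _ = _ := by ring
  -- the error sum factorises as well
  have herr : ∑ j ∈ box.filter (fun j => j i = m),
      (∏ k, R (j k)) * ∏ k ∈ Finset.univ.erase i, w k ^ (j k) =
      R m * ∏ k ∈ Finset.univ.erase i, ∑ n ∈ Finset.Icc 1 u, R n * w k ^ n := by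
    have h := fibre_modelSum_along i hm R w
    rw [← hbox] at h
    exact h
  -- and its product is at most `2^{t-1} P`
  have hprodle : ∏ k ∈ Finset.univ.erase i, ∑ n ∈ Finset.Icc 1 u, R n * w k ^ n ≤ 2 ^ (t - 1) * P := by
    have hcard : (Finset.univ.erase i).card = t - 1 := by
      rw [Finset.card_erase_of_mem (Finset.mem_univ i), Finset.card_univ, Fintype.card_fin]
    calc ∏ k ∈ Finset.univ.erase i, ∑ n ∈ Finset.Icc 1 u, R n * w k ^ n
        ≤ ∏ k ∈ Finset.univ.erase i, 2 * ∑ n ∈ Finset.Icc 1 u, I n * w k ^ n :=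
          Finset.prod_le_prod
            (fun k _ => Finset.sum_nonneg fun n _ => mul_nonneg (hR n) (pow_nonneg (hw k) n))
            fun k _ => hfac k
      _ = 2 ^ (t - 1) * P := by
          rw [Finset.prod_mul_distrib, Finset.prod_const, hcard, hP]
  -- assembly
  rw [hdiff]
  calc |∑ j ∈ box.filter (fun j => j i = m),
        (C j - M * ∏ k, I (j k)) * ∏ k ∈ Finset.univ.erase i, w k ^ (j k)|
      ≤ ∑ j ∈ box.filter (fun j => j i = m),
          |(C j - M * ∏ k, I (j k)) * ∏ k ∈ Finset.univ.erase i, w k ^ (j k)| :=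
        Finset.abs_sum_le_sum_abs _ _
    _ ≤ ∑ j ∈ box.filter (fun j => j i = m), ε * M *
          ((∏ k, R (j k)) * ∏ k ∈ Finset.univ.erase i, w k ^ (j k)) :=
        Finset.sum_le_sum hterm
    _ = ε * M * (R m * ∏ k ∈ Finset.univ.erase i, ∑ n ∈ Finset.Icc 1 u, R n * w k ^ n) := by
        rw [← Finset.mul_sum, herr]
    _ ≤ ε * M * (R m * (2 ^ (t - 1) * P)) :=
        mul_le_mul_of_nonneg_left (mul_le_mul_of_nonneg_left hprodle (hR m)) (mul_nonneg hε hM)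
    _ = 2 ^ (t - 1) * ε * (M * P) * R m := by ring

/-- Each tolerance factor is at most twice the model factor: for `2 ≤ u` and `0 ≤ x ≤ 1`,
`∑_{n=1}^u rowTol n u · x^n ≤ 2 ∑_{n=1}^u I_n(u) x^n` (the extra top term `I_{u-1}(u) x^u` is at most the
`n = u-1` term `I_{u-1}(u) x^{u-1}` of the model factor). -/
private theorem sum_rowTol_mul_pow_le {u : ℕ} (hu : 2 ≤ u) {x : ℝ} (hx0 : 0 ≤ x) (hx1 : x ≤ 1) :
    ∑ n ∈ Finset.Icc 1 u, rowTol n u * x ^ n ≤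
      2 * ∑ n ∈ Finset.Icc 1 u, cellDensity (n - 1) u * x ^ n := by
  have hsplit : ∑ n ∈ Finset.Icc 1 u, rowTol n u * x ^ n =
      ∑ n ∈ Finset.Icc 1 u, cellDensity (n - 1) u * x ^ n + cellDensity (u - 2) u * x ^ u := by
    have h : ∀ n ∈ Finset.Icc 1 u, rowTol n u * x ^ n =
        cellDensity (n - 1) u * x ^ n + (if n = u then cellDensity (u - 2) u * x ^ n else 0) := by
      intro n _
      unfold rowTol
      split_ifs <;> ring
    rw [Finset.sum_congr rfl h, Finset.sum_add_distrib, Finset.sum_ite_eq' (Finset.Icc 1 u) u,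
      if_pos (Finset.mem_Icc.2 ⟨by omega, le_rfl⟩)]
  have htop : cellDensity (u - 2) u * x ^ u ≤ ∑ n ∈ Finset.Icc 1 u, cellDensity (n - 1) u * x ^ n := by
    have hmem : u - 1 ∈ Finset.Icc 1 u := Finset.mem_Icc.2 ⟨by omega, by omega⟩
    have hs := Finset.single_le_sum (f := fun n => cellDensity (n - 1) u * x ^ n)
      (fun n _ => mul_nonneg (calc_nonneg _ _) (pow_nonneg hx0 n)) hmem
    have hu2 : u - 1 - 1 = u - 2 := by omega
    simp only [hu2] at hs
    refine le_trans ?_ hs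
    exact mul_le_mul_of_nonneg_left (pow_le_pow_of_le_one hx0 hx1 (by omega)) (calc_nonneg _ _)
  rw [hsplit]
  linarith

/-- Index shift `Σ_{m=1}^U f(m) = Σ_{j<U} f(j+1)`. -/
private theorem sum_Icc_one_eq_sum_range {A : Type*} [AddCommMonoid A] (U : ℕ) (f : ℕ → A) :
    ∑ m ∈ Finset.Icc 1 U, f m = ∑ j ∈ Finset.range U, f (j + 1) := by
  rw [← Finset.Ico_add_one_right_eq_Icc, Finset.sum_Ico_eq_sum_range, Nat.add_sub_cancel]
  exact Finset.sum_congr rfl fun j _ => by rw [add_comm]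

/-- `2^{t-1} e^{-tU} ≤ 1` for `1 ≤ U`. -/
private theorem two_pow_mul_exp_neg_le_one (t : ℕ) {U : ℕ} (hU : 1 ≤ U) :
    (2 : ℝ) ^ (t - 1) * Real.exp (-((t : ℝ) * U)) ≤ 1 := by
  have h1 : (2 : ℝ) ^ (t - 1) ≤ Real.exp ((t : ℝ) * U) := by
    calc (2 : ℝ) ^ (t - 1) ≤ 2 ^ t := pow_le_pow_right₀ one_le_two (Nat.sub_le t 1)
      _ ≤ Real.exp 1 ^ t :=
          pow_le_pow_left₀ (by norm_num) (by linarith [Real.add_one_le_exp (1 : ℝ)]) t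
      _ = Real.exp t := by rw [← Real.exp_nat_mul, mul_one]
      _ ≤ Real.exp ((t : ℝ) * U) := by
          refine Real.exp_le_exp.mpr (le_mul_of_one_le_right (Nat.cast_nonneg t) ?_)
          exact_mod_cast hU
  rw [Real.exp_neg, mul_inv_le_iff₀ (Real.exp_pos _), one_mul]
  exact h1

/-! ## The registered stub -/

/-- **`stub_transferAlong` (registered; M–L, fibre expansion + perturbation).**  Cells near rank one + robust
row ⟹ the crux in dip form: the fibre in coordinate `i` is `(M G_i(w)) · ζ · Σ_{j<U} b_j ζ^j` with
`G_i(w) = ∏_{k≠i} Σ_{n≤U} I_n(U) w_k^n > 0` (`w_k > 0` load-bearing) and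
`|b_j − I_{j+1}(U)| ≤ 2^{t-1} e^{-CU} rowTol (j+1) U ≤ e^{-C₀U} rowTol (j+1) U` for `C := C₀ + t`; along the
schedule `U = slowDegree N ≥ u₀` eventually (`quantClip_schedule`), so `RobustRowExp` applies to the row `b`. -/
theorem stub_transferAlong :
    CellsNearRankOneAlong → RobustRowExp →
      AbsoluteUpgrade.DipMarginRateExchange.FibreHyperbolicityAlong := by
  intro hCells hRow t L ht η hη
  obtain ⟨C₀, _hC₀, u₀, hrow⟩ := hRow
  obtain ⟨N₀, hN₀⟩ := hCells t L ht η hη (C₀ + t)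
  obtain ⟨N₁, hN₁⟩ := quantClip_schedule u₀
  refine ⟨max N₀ N₁, fun N hN Ψ hΨ hL K hK hKN hmass i w hw ζ hζ => ?_⟩
  have hU₀ : u₀ ≤ slowDegree N := (hN₁ N (le_of_max_le_right hN)).1
  have hU4 : 4 ≤ slowDegree N := four_le_slowDegree N
  obtain ⟨M, hM, hcell⟩ := hN₀ N (le_of_max_le_left hN) Ψ hΨ hL K hK hKN hmass
  -- freeze the degree `U = slowDegree N`
  set U : ℕ := slowDegree N with hU
  -- the model row and the tolerances
  set I : ℕ → ℝ := fun n => cellDensity (n - 1) U with hI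
  have hI0 : ∀ n, 0 ≤ I n := fun n => calc_nonneg _ _
  have hI1 : I 1 = 1 := cellDensity_zero _
  have hR0 : ∀ n, 0 ≤ rowTol n U := by
    intro n
    unfold rowTol
    split_ifs
    · exact add_nonneg (calc_nonneg _ _) (calc_nonneg _ _)
    · rw [add_zero]; exact calc_nonneg _ _
  -- the normaliser `G = ∏_{k ≠ i} Σ_n I_n(U) w_k^n > 0`
  set G : ℝ := ∏ k ∈ Finset.univ.erase i, ∑ n ∈ Finset.Icc 1 U, I n * w k ^ n with hG
  have hGpos : 0 < G := by
    refine Finset.prod_pos fun k _ => ?_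
    have hmem : 1 ∈ Finset.Icc 1 U := Finset.mem_Icc.mpr ⟨le_rfl, by omega⟩
    refine lt_of_lt_of_le ?_ (Finset.single_le_sum (f := fun n => I n * w k ^ n)
      (fun n _ => mul_nonneg (hI0 n) (pow_nonneg (hw k).1.le n)) hmem)
    rw [hI1, one_mul, pow_one]; exact (hw k).1
  have hMG : 0 < M * G := mul_pos hM hGpos
  -- the fibre coefficients
  set box : Finset (Fin t → ℕ) := Fintype.piFinset (fun _ : Fin t => Finset.Icc 1 U) with hbox
  set p : ℕ → ℝ := fun m => ∑ j ∈ box.filter (fun j => j i = m),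
    (jointCell t N U Ψ K j : ℝ) * ∏ k ∈ Finset.univ.erase i, w k ^ (j k) with hp
  set ε : ℝ := Real.exp (-((C₀ + t) * U)) with hε
  have hfac : ∀ k, ∑ n ∈ Finset.Icc 1 U, rowTol n U * w k ^ n ≤ 2 * ∑ n ∈ Finset.Icc 1 U, I n * w k ^ n :=
    fun k => sum_rowTol_mul_pow_le (by omega) (hw k).1.le (hw k).2
  have hcoeff : ∀ m ∈ Finset.Icc 1 U, |p m - M * G * I m| ≤ 2 ^ (t - 1) * ε * (M * G) * rowTol m U :=
    fun m hm => coeffBound_weighted i (fun j => (jointCell t N U Ψ K j : ℝ)) I (fun n => rowTol n U) w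
      hI0 hR0 hM.le (Real.exp_pos _).le (fun k => (hw k).1.le) hfac hcell hm
  -- the fibre expansion
  have hfib : fibre t N U Ψ K i w ζ = ∑ m ∈ Finset.Icc 1 U, ((p m : ℝ) : ℂ) * ζ ^ m :=
    fibreExpand t U i (jointCell t N U Ψ K) w ζ
  -- the normalised row
  set b : ℕ → ℝ := fun j => p (j + 1) / (M * G) with hb_def
  have h2exp : (2 : ℝ) ^ (t - 1) * Real.exp (-((t : ℝ) * U)) ≤ 1 :=
    two_pow_mul_exp_neg_le_one t (by omega)
  have hb : ∀ j : ℕ, j < U → |b j - cellDensity j U| ≤ Real.exp (-(C₀ * U)) * rowTol (j + 1) U := by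
    intro j hj
    have hmem : j + 1 ∈ Finset.Icc 1 U := Finset.mem_Icc.mpr ⟨by omega, by omega⟩
    have hc := hcoeff (j + 1) hmem
    have hIj : I (j + 1) = cellDensity j U := by simp [hI]
    rw [hIj] at hc
    have hdiv : b j - cellDensity j U = (p (j + 1) - M * G * cellDensity j U) / (M * G) := by
      simp only [hb_def]
      field_simp
    rw [hdiv, abs_div, abs_of_pos hMG, div_le_iff₀ hMG]
    have hRj : 0 ≤ rowTol (j + 1) U := hR0 _
    calc |p (j + 1) - M * G * cellDensity j U|
        ≤ 2 ^ (t - 1) * ε * (M * G) * rowTol (j + 1) U := hc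
      _ = (2 ^ (t - 1) * Real.exp (-((t : ℝ) * U))) *
            (Real.exp (-(C₀ * U)) * rowTol (j + 1) U * (M * G)) := by
          rw [hε, show -((C₀ + t) * (U : ℝ)) = -((t : ℝ) * U) + -(C₀ * U) by ring, Real.exp_add]
          ring
      _ ≤ 1 * (Real.exp (-(C₀ * U)) * rowTol (j + 1) U * (M * G)) :=
          mul_le_mul_of_nonneg_right h2exp
            (mul_nonneg (mul_nonneg (Real.exp_pos _).le hRj) hMG.le)
      _ = Real.exp (-(C₀ * U)) * rowTol (j + 1) U * (M * G) := one_mul _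
  -- the fibre as `(M G) ζ Σ_j b_j ζ^j`
  have hfactor : fibre t N U Ψ K i w ζ =
      ((M * G : ℝ) : ℂ) * ζ * ∑ j ∈ Finset.range U, ((b j : ℝ) : ℂ) * ζ ^ j := by
    rw [hfib, sum_Icc_one_eq_sum_range, Finset.mul_sum]
    refine Finset.sum_congr rfl fun j _ => ?_
    have hMGc : ((M * G : ℝ) : ℂ) ≠ 0 := Complex.ofReal_ne_zero.mpr hMG.ne'
    simp only [hb_def, Complex.ofReal_div]
    field_simp
    ring
  -- conclude
  rw [hfactor] at hζ
  rcases mul_eq_zero.mp hζ with h1 | h2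
  · rcases mul_eq_zero.mp h1 with h3 | h4
    · exact absurd (Complex.ofReal_eq_zero.mp h3) hMG.ne'
    · simp [h4]
  · exact hrow U hU₀ b hb ζ h2

end Summit.Parity.GeneralizedHardyLittlewood.Cruxes.FibreHyperbolicityAlong.SiftedChowlaDistillation

end
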